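import Mathlib
import HarnessLib

/-!
# Crux `EvenPatternDecoupling` (stmt-CriticalPhenomena-16133), line `registered`: ratio limits from ball laws (abstract core)

`exists_tendsto_div_of_ballLaws` (line skeleton, cycle-1 worker reduction, proved; landed here unchanged, binders closed at `Type`):
if for every relation set the "ball laws" `δ ↦ P (disc δ (gball (p i)))_i R` converge along `𝓝[>] 0` for every
generalised-ball datum `p` with non-zero radii (`gball (x, ρ) = closedBall x ρ` if `0 < ρ`, else `(ball x (-ρ))ᶜ`), and the
`R₂`-law of the family (inner closed balls) ++ (outer complements) does not tend to `0`, then the ratio of the `R₁`- and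
`R₂`-laws of that family converges (the family is the generalised-ball family of `Fin.append (b_j, s_j) (c_j, -r_j)`).
With `not_tendsto_zero_of_eventually_le` this is how the line turns crux A's existence clause (item 16131) and the RSW-type
non-degeneracy [N] into the ball-conditioned even-pattern limits (birth stub 1).
-/

namespace Summit.CriticalPhenomena.Ising3DConformalLimit.Theorems.EvenPatternDecoupling

open scoped Topology
open Filter Set Metric

/-- An eventual positive lower bound along a non-trivial filter excludes convergence to `0`
(the RSW-type form of non-degeneracy implies the `¬ Tendsto … (𝓝 0)` form). -/
theorem not_tendsto_zero_of_eventually_le {α : Type*} {l : Filter α} [l.NeBot] {g : α → ℝ} {m : ℝ}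
    (hm : 0 < m) (h : ∀ᶠ x in l, m ≤ g x) : ¬ Tendsto g l (𝓝 0) := by
  intro hg
  have hlt : ∀ᶠ x in l, g x < m := hg (Iio_mem_nhds hm)
  obtain ⟨x, hx1, hx2⟩ := (h.and hlt).exists
  exact absurd hx1 (not_le.2 hx2)

/-- **Abstract core.** Let `P` be any functional of a family of `n + n` lattice sets and a relation set, and
`disc δ` any discretisation of subsets of a metric space `X`. If for every relation set `R` the "ball laws"
exist — `δ ↦ P (disc δ (gball (p i)))_i R` converges along `𝓝[>] 0` for every generalised-ball datum `p`
with non-zero radii (`gball (x, ρ) = closedBall x ρ` if `0 < ρ`, else `(ball x (-ρ))ᶜ`) — and the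
`R₂`-probability of the family (inner closed balls `closedBall (b j) (s j)`) ++ (outer complements
`(ball (c j) (r j))ᶜ`) does not tend to `0`, then the ratio `P(…) R₁ / P(…) R₂` of that family converges.
Proof: the family is the generalised-ball family of the datum `Fin.append (b_j, s_j) (c_j, -r_j)`
(`Fin.addCases`), so both numerator and denominator converge; the denominator limit is `≠ 0`; `Tendsto.div`. -/
-- the header below is the registered stub signature (whitespace-compressed; binders closed at `Type`)
theorem exists_tendsto_div_of_ballLaws : open Filter Set Metric Topology in ∀ {X S : Type} [PseudoMetricSpace X] {n : ℕ} (P : (Fin (n + n)→Set S)→Set (Fin (n + n)→Fin (n + n)→Prop)→ℝ) (disc : ℝ→Set X→Set S) (hA : ∀ R : Set (Fin (n + n)→Fin (n + n)→Prop), ∃ lam : (Fin (n + n)→X × ℝ)→ℝ, ∀ p : Fin (n + n)→X × ℝ, (∀ i, (p i).2 ≠ 0)→Tendsto (fun δ=>P (fun i=>disc δ (if 0 < (p i).2 then Metric.closedBall (p i).1 (p i).2 else (Metric.ball (p i).1 (-(p i).2))ᶜ)) R) (𝓝[>] 0) (𝓝 (lam p))) (b c : Fin n→X) (s r : Fin n→ℝ)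 (hs : ∀ j, 0 < s j) (hr : ∀ j, 0 < r j) (R₁ R₂ : Set (Fin (n + n)→Fin (n + n)→Prop)) (hpos : ¬ Tendsto (fun δ=>P (Fin.append (fun j=>disc δ (Metric.closedBall (b j) (s j))) (fun j=>disc δ (Metric.ball (c j) (r j))ᶜ)) R₂) (𝓝[>] 0) (𝓝 0)), ∃ M : ℝ, Tendsto (fun δ=>P (Fin.append (fun j=>disc δ (Metric.closedBall (b j) (s j))) (fun j=>disc δ (Metric.ball (c j) (r j))ᶜ)) R₁ / P (Fin.append (fun j=>disc δ (Metric.closedBall (b j) (s j))) (fun j=>disc δ (Metric.ball (c j) (r j))ᶜ)) R₂) (𝓝[>] 0) (𝓝 M) := by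
  intro X S _ n P disc hA b c s r hs hr R₁ R₂ hpos
  -- the generalised-ball datum: inner closed balls (positive radii) ++ outer exteriors (negative radii)
  obtain ⟨p, hp_def⟩ : ∃ p : Fin (n + n) → X × ℝ,
      p = Fin.append (fun j => (b j, s j)) (fun j => (c j, -(r j))) := ⟨_, rfl⟩
  have hp : ∀ i, (p i).2 ≠ 0 := by
    intro i
    induction i using Fin.addCases with
    | left j => rw [hp_def, Fin.append_left]; exact (hs j).ne'
    | right j => rw [hp_def, Fin.append_right]; exact neg_ne_zero.2 (hr j).ne'
  have hfam : ∀ δ : ℝ, (fun i => disc δ (if 0 < (p i).2 then Metric.closedBall (p i).1 (p i).2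
      else (Metric.ball (p i).1 (-(p i).2))ᶜ)) =
      Fin.append (fun j => disc δ (Metric.closedBall (b j) (s j)))
        (fun j => disc δ (Metric.ball (c j) (r j))ᶜ) := by
    intro δ
    funext i
    induction i using Fin.addCases with
    | left j => simp only [hp_def, Fin.append_left, if_pos (hs j)]
    | right j =>
      have hneg : ¬ (0 < -(r j)) := not_lt.2 (neg_nonpos.2 (hr j).le)
      simp only [hp_def, Fin.append_right, if_neg hneg, neg_neg]
  have hlim : ∀ R : Set (Fin (n + n) → Fin (n + n) → Prop), ∃ l : ℝ,
      Tendsto (fun δ => P (Fin.append (fun j => disc δ (Metric.closedBall (b j) (s j)))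
        (fun j => disc δ (Metric.ball (c j) (r j))ᶜ)) R) (𝓝[>] 0) (𝓝 l) := by
    intro R
    obtain ⟨lam, hlam⟩ := hA R
    refine ⟨lam p, ?_⟩
    have h := hlam p hp
    simp only [hfam] at h
    exact h
  obtain ⟨l₁, h₁⟩ := hlim R₁
  obtain ⟨l₂, h₂⟩ := hlim R₂
  have hl₂ : l₂ ≠ 0 := by
    intro h0
    rw [h0] at h₂
    exact hpos h₂
  exact ⟨l₁ / l₂, h₁.div h₂ hl₂⟩

end Summit.CriticalPhenomena.Ising3DConformalLimit.Theorems.EvenPatternDecoupling
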